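import Summits.AtomisticToContinuum.Crystallization.Theorems.FreeSplittingCertificatesStrictSplittingRuleLineTrussAsymptoticsTau

/-!
# `StrictSplittingRule` (stmt-AtomisticToContinuum-12560): second-order Euler–Maclaurin for the line-truss tension — calculus and the lattice sum

Route `FreeSplittingCertificates`, crux r3 `StrictSplittingRule`, line `registered` (unit b2b-freesplit-B, gen 14).  The far lemma of the
H12⋆ architecture (HOME CERT.md §16/§20, FAR-LEMMA-SPEC §11 (d)(1)) needs a TRUE-β inflation bound: the readout coefficient of the landed
first-order design is `β = λ_s·τ` with `τ` the line-truss tension, and the tree's first-order brick `h1_tail_asymp`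
(`…LineTrussAsymptotics.lean`: `τ = r⁻⁶/12 + O(‖e‖r⁻⁷)` with constant `16(2C₂ + C₁)(ρ₀)`) is numerically usable only beyond several
hundred lattice spacings.  This file and its sequel prove the SECOND-ORDER expansion
`τ = −½V_LJ(r) − ½W′(r²)⟪v,e⟫ + R₂`, `|R₂| ≤ (K₂/12)(‖e‖³r⁻⁹ + (5π/32)‖e‖²r⁻⁸)`, `K₂ = 52 + 133 r⁻⁶` (trapezoid rule per unit
step with the `∫(s−k−½)²ds = 1/12` remainder), which certifies the inflation `12r⁶τ ≤ 1.45` from `20a` on and `≤ 3.2` from `8a` on.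
Here: the calculus (`W‴`, the second derivative `F″` of the summand and its bound `|F″| ≤ K₂‖e‖³‖v+te‖⁻⁹` on outgoing lines) and
the lattice sum `Σ_{k≥0}(r² + k²ε²)⁻⁴ ≤ r⁻⁸ + (5π/32)r⁻⁷/ε` (comparison with the explicit arctangent primitive).
Structural bookkeeping ([folklore]: elementary calculus); VALUE = a kernel-checked brick of the far lemma — NOT a proof of H12⋆,
NOT summit progress.
-/

noncomputable section

namespace Summit.AtomisticToContinuum.Crystallization.Theorems.StrictSplittingRuleBirth

open scoped BigOperators Topology
open Filter Set
open Literature.MathematicalPhysics.StatisticalMechanics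
open Summit.AtomisticToContinuum.Crystallization.Theorems.PalmUnimodularRigidity.LayeredLawsSelectHcp

/-! ## §1 Third derivative of the squared-length well and the second derivative of the load -/

/-- `W‴`: the function `σ ↦ W″(σ) = (7/2)σ⁻⁸ − 2σ⁻⁵` has derivative `10σ⁻⁶ − 28σ⁻⁹` at `σ ≠ 0`. [folklore] -/
theorem hasDerivAt_ljSqDeriv2 {σ : ℝ} (hσ : σ ≠ 0) :
    HasDerivAt (fun σ : ℝ => 7 / 2 * (σ⁻¹) ^ 8 - 2 * (σ⁻¹) ^ 5) (10 * (σ⁻¹) ^ 6 - 28 * (σ⁻¹) ^ 9) σ := by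
  have hinv : HasDerivAt (fun s : ℝ => s⁻¹) (-(σ ^ 2)⁻¹) σ := hasDerivAt_inv hσ
  have h8 : HasDerivAt (fun y : ℝ => y⁻¹ ^ 8) (((8 : ℕ) : ℝ) * σ⁻¹ ^ (8 - 1) * -(σ ^ 2)⁻¹) σ := hinv.pow 8
  have h5 : HasDerivAt (fun y : ℝ => y⁻¹ ^ 5) (((5 : ℕ) : ℝ) * σ⁻¹ ^ (5 - 1) * -(σ ^ 2)⁻¹) σ := hinv.pow 5
  have h : HasDerivAt (fun y : ℝ => 7 / 2 * y⁻¹ ^ 8 - 2 * y⁻¹ ^ 5)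
      (7 / 2 * (((8 : ℕ) : ℝ) * σ⁻¹ ^ (8 - 1) * -(σ ^ 2)⁻¹) -
        2 * (((5 : ℕ) : ℝ) * σ⁻¹ ^ (5 - 1) * -(σ ^ 2)⁻¹)) σ :=
    HasDerivAt.sub (HasDerivAt.const_mul (7 / 2) h8) (HasDerivAt.const_mul 2 h5)
  refine HasDerivAt.congr_deriv h ?_
  push_cast
  field_simp
  ring

/-- `|W‴(σ)| ≤ (10 + 28σ₀⁻³)·σ⁻⁶` for `σ ≥ σ₀ > 0`. [folklore] -/
theorem abs_ljSqDeriv3_le {σ₀ σ : ℝ} (h0 : 0 < σ₀) (hσ : σ₀ ≤ σ) :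
    |10 * (σ⁻¹) ^ 6 - 28 * (σ⁻¹) ^ 9| ≤ (10 + 28 * (σ₀⁻¹) ^ 3) * (σ⁻¹) ^ 6 := by
  have hs : 0 < σ := h0.trans_le hσ
  have hi : σ⁻¹ ≤ σ₀⁻¹ := (inv_le_inv₀ hs h0).2 hσ
  have hi0 : 0 ≤ σ⁻¹ := inv_nonneg.2 hs.le
  have h9 : (σ⁻¹) ^ 9 ≤ (σ₀⁻¹) ^ 3 * (σ⁻¹) ^ 6 := by
    rw [show (σ⁻¹) ^ 9 = (σ⁻¹) ^ 3 * (σ⁻¹) ^ 6 by ring]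
    exact mul_le_mul_of_nonneg_right (pow_le_pow_left₀ hi0 hi 3) (by positivity)
  have h6 : 0 ≤ (σ⁻¹) ^ 6 := by positivity
  have h9' : 0 ≤ (σ⁻¹) ^ 9 := by positivity
  have hc : 0 ≤ 28 * (σ₀⁻¹) ^ 3 * (σ⁻¹) ^ 6 := by positivity
  rw [abs_le]
  constructor <;> nlinarith [h9, h6, h9', hc]

section Line

variable {v e : EuclideanSpace ℝ (Fin 3)}

/-- **Second derivative of the summand** along the line: with `σ = ‖v+te‖²`, `p = ⟪v+te, e⟫`,
`F″(t) = W‴(σ)·4p³ + W″(σ)·6p‖e‖²`. [folklore] -/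
theorem h1_line_hasDerivAt_load2 {t : ℝ} (hq : ‖v + t • e‖ ^ 2 ≠ 0) :
    HasDerivAt (fun t : ℝ =>
        (7 / 2 * ((‖v + t • e‖ ^ 2)⁻¹) ^ 8 - 2 * ((‖v + t • e‖ ^ 2)⁻¹) ^ 5) * (2 * inner ℝ (v + t • e) e ^ 2) +
          ljSqDeriv (‖v + t • e‖ ^ 2) * ‖e‖ ^ 2)
      ((10 * ((‖v + t • e‖ ^ 2)⁻¹) ^ 6 - 28 * ((‖v + t • e‖ ^ 2)⁻¹) ^ 9) * (4 * inner ℝ (v + t • e) e ^ 3) +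
        (7 / 2 * ((‖v + t • e‖ ^ 2)⁻¹) ^ 8 - 2 * ((‖v + t • e‖ ^ 2)⁻¹) ^ 5) *
          (6 * inner ℝ (v + t • e) e * ‖e‖ ^ 2)) t := by
  have hq' : HasDerivAt (fun t : ℝ => ‖v + t • e‖ ^ 2) (2 * inner ℝ v e + 2 * t * ‖e‖ ^ 2) t :=
    h1_line_hasDerivAt_norm_sq v e t
  have hin : HasDerivAt (fun t : ℝ => inner ℝ (v + t • e) e) (0 + 1 * ‖e‖ ^ 2) t := by
    have e2 : (fun t : ℝ => inner ℝ (v + t • e) e) = fun t => inner ℝ v e + t * ‖e‖ ^ 2 :=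
      funext fun t => h1_line_inner v e t
    rw [e2]
    exact HasDerivAt.add (hasDerivAt_const t _) (HasDerivAt.mul_const (hasDerivAt_id' t) _)
  have hp2 : HasDerivAt (fun t : ℝ => 2 * inner ℝ (v + t • e) e ^ 2)
      (2 * (((2 : ℕ) : ℝ) * inner ℝ (v + t • e) e ^ (2 - 1) * (0 + 1 * ‖e‖ ^ 2))) t :=
    HasDerivAt.const_mul 2 (hin.pow 2)
  have hW2 : HasDerivAt ((fun σ : ℝ => 7 / 2 * (σ⁻¹) ^ 8 - 2 * (σ⁻¹) ^ 5) ∘ fun t : ℝ => ‖v + t • e‖ ^ 2)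
      ((10 * ((‖v + t • e‖ ^ 2)⁻¹) ^ 6 - 28 * ((‖v + t • e‖ ^ 2)⁻¹) ^ 9) *
        (2 * inner ℝ v e + 2 * t * ‖e‖ ^ 2)) t :=
    (hasDerivAt_ljSqDeriv2 hq).comp t hq'
  have hW1 : HasDerivAt (ljSqDeriv ∘ fun t : ℝ => ‖v + t • e‖ ^ 2)
      ((7 / 2 * ((‖v + t • e‖ ^ 2)⁻¹) ^ 8 - 2 * ((‖v + t • e‖ ^ 2)⁻¹) ^ 5) * (2 * inner ℝ v e + 2 * t * ‖e‖ ^ 2)) t :=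
    (hasDerivAt_ljSqDeriv hq).comp t hq'
  have h := (hW2.mul hp2).add (hW1.mul_const (‖e‖ ^ 2))
  refine HasDerivAt.congr_deriv h ?_
  simp only [Function.comp]
  rw [h1_line_inner]
  push_cast
  ring

/-- **Bound on `F″`** on an outgoing line (`⟪v,e⟫ ≥ 0`, `t ≥ 0`, `v ≠ 0`):
`|F″(t)| ≤ (52 + 133‖v‖⁻⁶)·‖e‖³·‖v + te‖⁻⁹` (Cauchy–Schwarz `0 ≤ p ≤ ‖v+te‖‖e‖`, `|W‴(σ)| ≤ (10 + 28‖v‖⁻⁶)σ⁻⁶`,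
`|W″(σ)| ≤ (2 + (7/2)‖v‖⁻⁶)σ⁻⁵` for `σ ≥ ‖v‖²`). [folklore] -/
theorem h1_line_load2_le (hv : 0 < ‖v‖) (hve : 0 ≤ inner ℝ v e) {t : ℝ} (ht : 0 ≤ t) :
    |(10 * ((‖v + t • e‖ ^ 2)⁻¹) ^ 6 - 28 * ((‖v + t • e‖ ^ 2)⁻¹) ^ 9) * (4 * inner ℝ (v + t • e) e ^ 3) +
        (7 / 2 * ((‖v + t • e‖ ^ 2)⁻¹) ^ 8 - 2 * ((‖v + t • e‖ ^ 2)⁻¹) ^ 5) *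
          (6 * inner ℝ (v + t • e) e * ‖e‖ ^ 2)| ≤
      (52 + 133 * (‖v‖⁻¹) ^ 6) * ‖e‖ ^ 3 * (‖v + t • e‖⁻¹) ^ 9 := by
  set n := ‖v + t • e‖ with hn
  set σ := ‖v + t • e‖ ^ 2 with hσ
  set p := inner ℝ (v + t • e) e with hp
  set c := (‖v‖⁻¹) ^ 6 with hc
  have hσn : σ = n ^ 2 := by rw [hσ, hn]
  have hσ₀ : ‖v‖ ^ 2 ≤ σ := le_trans (by nlinarith) (h1_line_norm_sq_ge hve ht).1
  have hv2 : 0 < ‖v‖ ^ 2 := by positivity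
  have hσpos : 0 < σ := hv2.trans_le hσ₀
  have hnpos : 0 < n := by
    have : 0 ≤ n := norm_nonneg _
    rcases this.eq_or_lt with h0 | h0
    · exfalso; rw [hσn, ← h0] at hσpos; simp at hσpos
    · exact h0
  have hp0 : 0 ≤ p := by rw [hp, h1_line_inner]; positivity
  have hpn : p ≤ n * ‖e‖ := by rw [hp, hn]; exact real_inner_le_norm _ _
  have hc' : ((‖v‖ ^ 2)⁻¹) ^ 3 = c := by rw [hc, inv_pow, inv_pow, ← pow_mul]
  have hW3 : |10 * (σ⁻¹) ^ 6 - 28 * (σ⁻¹) ^ 9| ≤ (10 + 28 * c) * (σ⁻¹) ^ 6 := by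
    have := abs_ljSqDeriv3_le hv2 hσ₀; rwa [hc'] at this
  have hW2 : |7 / 2 * (σ⁻¹) ^ 8 - 2 * (σ⁻¹) ^ 5| ≤ (2 + 7 / 2 * c) * (σ⁻¹) ^ 5 := by
    have := abs_ljSqDeriv_deriv_le hv2 hσ₀; rwa [hc'] at this
  have hc0 : 0 ≤ c := by positivity
  have hne : 0 ≤ n * ‖e‖ := by positivity
  have hp3 : p ^ 3 ≤ (n * ‖e‖) ^ 3 := pow_le_pow_left₀ hp0 hpn 3
  have hA : |(10 * (σ⁻¹) ^ 6 - 28 * (σ⁻¹) ^ 9) * (4 * p ^ 3)| ≤ (10 + 28 * c) * (σ⁻¹) ^ 6 * (4 * (n * ‖e‖) ^ 3) := by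
    rw [abs_mul, abs_of_nonneg (by positivity : (0:ℝ) ≤ 4 * p ^ 3)]
    exact mul_le_mul hW3 (by linarith) (by positivity) (by positivity)
  have hB : |(7 / 2 * (σ⁻¹) ^ 8 - 2 * (σ⁻¹) ^ 5) * (6 * p * ‖e‖ ^ 2)| ≤
      (2 + 7 / 2 * c) * (σ⁻¹) ^ 5 * (6 * (n * ‖e‖) * ‖e‖ ^ 2) := by
    rw [abs_mul, abs_of_nonneg (by positivity : (0:ℝ) ≤ 6 * p * ‖e‖ ^ 2)]
    refine mul_le_mul hW2 ?_ (by positivity) (by positivity)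
    have : 6 * p * ‖e‖ ^ 2 ≤ 6 * (n * ‖e‖) * ‖e‖ ^ 2 := by gcongr
    exact this
  have e1 : (σ⁻¹) ^ 6 * n ^ 3 = (n⁻¹) ^ 9 := by
    rw [hσn]; field_simp
  have e2 : (σ⁻¹) ^ 5 * n = (n⁻¹) ^ 9 := by
    rw [hσn]; field_simp
  calc |(10 * (σ⁻¹) ^ 6 - 28 * (σ⁻¹) ^ 9) * (4 * p ^ 3) + (7 / 2 * (σ⁻¹) ^ 8 - 2 * (σ⁻¹) ^ 5) * (6 * p * ‖e‖ ^ 2)|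
      ≤ |(10 * (σ⁻¹) ^ 6 - 28 * (σ⁻¹) ^ 9) * (4 * p ^ 3)| + |(7 / 2 * (σ⁻¹) ^ 8 - 2 * (σ⁻¹) ^ 5) * (6 * p * ‖e‖ ^ 2)| :=
        abs_add_le _ _
    _ ≤ (10 + 28 * c) * (σ⁻¹) ^ 6 * (4 * (n * ‖e‖) ^ 3) + (2 + 7 / 2 * c) * (σ⁻¹) ^ 5 * (6 * (n * ‖e‖) * ‖e‖ ^ 2) :=
        add_le_add hA hB
    _ = (4 * (10 + 28 * c)) * ‖e‖ ^ 3 * ((σ⁻¹) ^ 6 * n ^ 3) + (6 * (2 + 7 / 2 * c)) * ‖e‖ ^ 3 * ((σ⁻¹) ^ 5 * n) := by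
        ring
    _ = (52 + 133 * c) * ‖e‖ ^ 3 * (n⁻¹) ^ 9 := by rw [e1, e2]; ring

end Line

/-! ## §2 The lattice sum `Σ_{k ≥ 0} (r² + k²ε²)⁻⁴` via the arctangent primitive -/

section Sum

/-- The primitive of `t ↦ (r² + ε²t²)⁻⁴` vanishing at `0`:
`G(t) = t(15ε⁴t⁴ + 40ε²t²r² + 33r⁴)/(48r⁶(r²+ε²t²)³) + (5/16)(r⁻⁷/ε)·arctan(εt/r)`. [folklore] -/
theorem h1_quartic_prim_hasDerivAt {r ε : ℝ} (hr : 0 < r) (hε : 0 < ε) (t : ℝ) :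
    HasDerivAt (fun t : ℝ => t * (15 * ε ^ 4 * t ^ 4 + 40 * ε ^ 2 * t ^ 2 * r ^ 2 + 33 * r ^ 4) /
          (48 * r ^ 6 * (r ^ 2 + ε ^ 2 * t ^ 2) ^ 3) + 5 / 16 * ((r⁻¹) ^ 7 / ε) * Real.arctan (ε * t / r))
      (((r ^ 2 + ε ^ 2 * t ^ 2)⁻¹) ^ 4) t := by
  have hq : 0 < r ^ 2 + ε ^ 2 * t ^ 2 := by positivity
  -- the rational part
  have hnum : HasDerivAt (fun t : ℝ => t * (15 * ε ^ 4 * t ^ 4 + 40 * ε ^ 2 * t ^ 2 * r ^ 2 + 33 * r ^ 4))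
      (1 * (15 * ε ^ 4 * t ^ 4 + 40 * ε ^ 2 * t ^ 2 * r ^ 2 + 33 * r ^ 4) +
        t * (15 * ε ^ 4 * (((4 : ℕ) : ℝ) * t ^ (4 - 1)) + 40 * ε ^ 2 * (((2 : ℕ) : ℝ) * t ^ (2 - 1)) * r ^ 2 + 0)) t := by
    refine HasDerivAt.mul (hasDerivAt_id' t) ?_
    refine HasDerivAt.add (HasDerivAt.add ?_ ?_) (hasDerivAt_const t _)
    · exact HasDerivAt.const_mul _ (hasDerivAt_pow 4 t)
    · exact HasDerivAt.mul_const (HasDerivAt.const_mul _ (hasDerivAt_pow 2 t)) _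
  have hden : HasDerivAt (fun t : ℝ => 48 * r ^ 6 * (r ^ 2 + ε ^ 2 * t ^ 2) ^ 3)
      (48 * r ^ 6 * (((3 : ℕ) : ℝ) * (r ^ 2 + ε ^ 2 * t ^ 2) ^ (3 - 1) * (0 + ε ^ 2 * (((2 : ℕ) : ℝ) * t ^ (2 - 1))))) t := by
    refine HasDerivAt.const_mul _ ?_
    have hin : HasDerivAt (fun t : ℝ => r ^ 2 + ε ^ 2 * t ^ 2) (0 + ε ^ 2 * (((2 : ℕ) : ℝ) * t ^ (2 - 1))) t :=
      HasDerivAt.add (hasDerivAt_const t _) (HasDerivAt.const_mul _ (hasDerivAt_pow 2 t))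
    exact hin.pow 3
  have hden0 : 48 * r ^ 6 * (r ^ 2 + ε ^ 2 * t ^ 2) ^ 3 ≠ 0 := by positivity
  have hrat := hnum.div hden hden0
  -- the arctangent part
  have hlin : HasDerivAt (fun t : ℝ => ε * t / r) (ε * 1 / r) t :=
    HasDerivAt.div_const (HasDerivAt.const_mul ε (hasDerivAt_id' t)) r
  have hat : HasDerivAt (Real.arctan ∘ fun t : ℝ => ε * t / r) (1 / (1 + (ε * t / r) ^ 2) * (ε * 1 / r)) t :=
    (Real.hasDerivAt_arctan (ε * t / r)).comp t hlin
  have hat' := HasDerivAt.const_mul (5 / 16 * ((r⁻¹) ^ 7 / ε)) hat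
  have h := hrat.add hat'
  refine HasDerivAt.congr_deriv h ?_
  push_cast
  field_simp
  ring

/-- The rational part of the primitive is nonnegative and at most `33/(48 r⁶ ε² t)` for `t > 0`. [folklore] -/
theorem h1_quartic_prim_rat_le {r ε t : ℝ} (hr : 0 < r) (hε : 0 < ε) (ht : 0 < t) :
    0 ≤ t * (15 * ε ^ 4 * t ^ 4 + 40 * ε ^ 2 * t ^ 2 * r ^ 2 + 33 * r ^ 4) / (48 * r ^ 6 * (r ^ 2 + ε ^ 2 * t ^ 2) ^ 3) ∧
      t * (15 * ε ^ 4 * t ^ 4 + 40 * ε ^ 2 * t ^ 2 * r ^ 2 + 33 * r ^ 4) / (48 * r ^ 6 * (r ^ 2 + ε ^ 2 * t ^ 2) ^ 3) ≤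
        33 / (48 * r ^ 6 * ε ^ 2 * t) := by
  have hq : 0 < r ^ 2 + ε ^ 2 * t ^ 2 := by positivity
  refine ⟨by positivity, ?_⟩
  rw [div_le_div_iff₀ (by positivity) (by positivity)]
  have h1 : 15 * ε ^ 4 * t ^ 4 + 40 * ε ^ 2 * t ^ 2 * r ^ 2 + 33 * r ^ 4 ≤ 33 * (r ^ 2 + ε ^ 2 * t ^ 2) ^ 2 := by
    nlinarith [sq_nonneg (ε ^ 2 * t ^ 2), sq_nonneg (ε * t * r)]
  have h2 : ε ^ 2 * t ^ 2 ≤ r ^ 2 + ε ^ 2 * t ^ 2 := by nlinarith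
  calc t * (15 * ε ^ 4 * t ^ 4 + 40 * ε ^ 2 * t ^ 2 * r ^ 2 + 33 * r ^ 4) * (48 * r ^ 6 * ε ^ 2 * t)
      = (15 * ε ^ 4 * t ^ 4 + 40 * ε ^ 2 * t ^ 2 * r ^ 2 + 33 * r ^ 4) * (ε ^ 2 * t ^ 2) * (48 * r ^ 6) := by ring
    _ ≤ 33 * (r ^ 2 + ε ^ 2 * t ^ 2) ^ 2 * (r ^ 2 + ε ^ 2 * t ^ 2) * (48 * r ^ 6) := by
        gcongr
    _ = 33 * (48 * r ^ 6 * (r ^ 2 + ε ^ 2 * t ^ 2) ^ 3) := by ring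

/-- **The lattice sum.**  For `r, ε > 0` the sequence `k ↦ (r² + k²ε²)⁻⁴` is summable and
`Σ_{k ≥ 0} (r² + k²ε²)⁻⁴ ≤ r⁻⁸ + (5π/32)·r⁻⁷/ε` (integral comparison for the decreasing profile via the explicit
primitive `h1_quartic_prim_hasDerivAt`, `∫₀^∞ (1+u²)⁻⁴ du = 5π/32`). [folklore] -/
theorem h1_quartic_sum_le {r ε : ℝ} (hr : 0 < r) (hε : 0 < ε) :
    (Summable fun k : ℕ => ((r ^ 2 + (k : ℝ) ^ 2 * ε ^ 2)⁻¹) ^ 4) ∧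
      ∑' k : ℕ, ((r ^ 2 + (k : ℝ) ^ 2 * ε ^ 2)⁻¹) ^ 4 ≤ (r⁻¹) ^ 8 + 5 * Real.pi / 32 * ((r⁻¹) ^ 7 / ε) := by
  set g : ℝ → ℝ := fun t => ((r ^ 2 + ε ^ 2 * t ^ 2)⁻¹) ^ 4 with hg
  set G : ℝ → ℝ := fun t => t * (15 * ε ^ 4 * t ^ 4 + 40 * ε ^ 2 * t ^ 2 * r ^ 2 + 33 * r ^ 4) /
      (48 * r ^ 6 * (r ^ 2 + ε ^ 2 * t ^ 2) ^ 3) + 5 / 16 * ((r⁻¹) ^ 7 / ε) * Real.arctan (ε * t / r) with hG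
  set L : ℝ := 5 * Real.pi / 32 * ((r⁻¹) ^ 7 / ε) with hL
  have hGd : ∀ t, HasDerivAt G (g t) t := fun t => h1_quartic_prim_hasDerivAt hr hε t
  have hG0 : G 0 = 0 := by simp [hG]
  -- `g` is decreasing on `[0, ∞)`
  have hg_anti : ∀ {s t : ℝ}, 0 ≤ s → s ≤ t → g t ≤ g s := by
    intro s t hs hst
    have hqs : 0 < r ^ 2 + ε ^ 2 * s ^ 2 := by positivity
    have hle : r ^ 2 + ε ^ 2 * s ^ 2 ≤ r ^ 2 + ε ^ 2 * t ^ 2 := by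
      have := pow_le_pow_left₀ hs hst 2; nlinarith [sq_nonneg ε]
    exact pow_le_pow_left₀ (by positivity) (inv_anti₀ hqs hle) 4
  -- one step: `g k ≤ G k − G (k−1)` for `k ≥ 1`
  have hstep : ∀ k : ℕ, 1 ≤ k → g k ≤ G k - G ((k : ℝ) - 1) := by
    intro k hk
    have hk' : (1 : ℝ) ≤ k := by exact_mod_cast hk
    have hab : (k : ℝ) - 1 < k := by linarith
    obtain ⟨ξ, hξ, hξeq⟩ := exists_hasDerivAt_eq_slope G g hab
      (fun x _ => (hGd x).continuousAt.continuousWithinAt) (fun x _ => hGd x)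
    have e1 : (G k - G ((k : ℝ) - 1)) / ((k : ℝ) - ((k : ℝ) - 1)) = G k - G ((k : ℝ) - 1) := by
      rw [show (k : ℝ) - ((k : ℝ) - 1) = 1 by ring, div_one]
    rw [e1] at hξeq
    rw [← hξeq]
    exact hg_anti (by linarith [hξ.1]) hξ.2.le
  -- partial sums
  have hgk : ∀ k : ℕ, ((r ^ 2 + (k : ℝ) ^ 2 * ε ^ 2)⁻¹) ^ 4 = g k := fun k => by
    simp only [hg]; ring_nf
  have hpart : ∀ n : ℕ, ∑ k ∈ Finset.range (n + 1), g k ≤ (r⁻¹) ^ 8 + G n := by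
    intro n
    induction n with
    | zero =>
      simp only [zero_add, Finset.range_one, Finset.sum_singleton, Nat.cast_zero, hG0, add_zero]
      have hg0' : g 0 = (r⁻¹) ^ 8 := by
        simp only [hg, ne_eq, OfNat.ofNat_ne_zero, not_false_eq_true, zero_pow, mul_zero, add_zero, inv_pow]
        ring
      rw [hg0']
    | succ n ih =>
      rw [Finset.sum_range_succ]
      have := hstep (n + 1) (by omega)
      push_cast at this ⊢
      rw [show (n : ℝ) + 1 - 1 = n by ring] at this
      linarith
  -- uniform bound on `G`
  have hGle : ∀ n : ℕ, G n ≤ 33 / (48 * r ^ 6 * ε ^ 2) + L := by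
    intro n
    rcases Nat.eq_zero_or_pos n with h0 | hpos
    · subst h0; simp only [Nat.cast_zero]; rw [hG0]; positivity
    have hn : (0 : ℝ) < n := by exact_mod_cast hpos
    have hrat := (h1_quartic_prim_rat_le hr hε hn).2
    have hn1 : (1 : ℝ) ≤ n := by exact_mod_cast hpos
    have hrat' : 33 / (48 * r ^ 6 * ε ^ 2 * n) ≤ 33 / (48 * r ^ 6 * ε ^ 2) := by
      apply div_le_div_of_nonneg_left (by norm_num) (by positivity)
      have : 0 < 48 * r ^ 6 * ε ^ 2 := by positivity
      nlinarith
    have hat : Real.arctan (ε * n / r) ≤ Real.pi / 2 := (Real.arctan_lt_pi_div_two _).le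
    have hcoef : 0 ≤ 5 / 16 * ((r⁻¹) ^ 7 / ε) := by positivity
    have : 5 / 16 * ((r⁻¹) ^ 7 / ε) * Real.arctan (ε * n / r) ≤ L := by
      calc 5 / 16 * ((r⁻¹) ^ 7 / ε) * Real.arctan (ε * n / r) ≤ 5 / 16 * ((r⁻¹) ^ 7 / ε) * (Real.pi / 2) :=
            mul_le_mul_of_nonneg_left hat hcoef
        _ = L := by rw [hL]; ring
    simp only [hG]
    linarith
  have hnn : ∀ k : ℕ, 0 ≤ g k := fun k => by simp only [hg]; positivity
  have hbd : ∀ n : ℕ, ∑ k ∈ Finset.range n, g k ≤ (r⁻¹) ^ 8 + (33 / (48 * r ^ 6 * ε ^ 2) + L) := by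
    intro n
    rcases Nat.eq_zero_or_pos n with h0 | hpos
    · subst h0; simp; positivity
    · obtain ⟨m, rfl⟩ : ∃ m, n = m + 1 := ⟨n - 1, by omega⟩
      exact (hpart m).trans (by linarith [hGle m])
  have hsum : Summable fun k : ℕ => g k := summable_of_sum_range_le hnn hbd
  -- the limit of `G n`
  have hGlim : Tendsto (fun n : ℕ => G n) atTop (𝓝 L) := by
    have h1 : Tendsto (fun n : ℕ => (n : ℝ) * (15 * ε ^ 4 * (n : ℝ) ^ 4 + 40 * ε ^ 2 * (n : ℝ) ^ 2 * r ^ 2 + 33 * r ^ 4) /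
        (48 * r ^ 6 * (r ^ 2 + ε ^ 2 * (n : ℝ) ^ 2) ^ 3)) atTop (𝓝 0) := by
      have hup : Tendsto (fun n : ℕ => 33 / (48 * r ^ 6 * ε ^ 2 * (n : ℝ))) atTop (𝓝 0) := by
        have : Tendsto (fun n : ℕ => 48 * r ^ 6 * ε ^ 2 * (n : ℝ)) atTop atTop :=
          Tendsto.const_mul_atTop (by positivity) tendsto_natCast_atTop_atTop
        exact this.const_div_atTop 33 |>.congr fun n => rfl
      refine tendsto_of_tendsto_of_tendsto_of_le_of_le' tendsto_const_nhds hup ?_ ?_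
      · filter_upwards [eventually_gt_atTop 0] with n hn
        exact (h1_quartic_prim_rat_le hr hε (by exact_mod_cast hn : (0:ℝ) < n)).1
      · filter_upwards [eventually_gt_atTop 0] with n hn
        exact (h1_quartic_prim_rat_le hr hε (by exact_mod_cast hn : (0:ℝ) < n)).2
    have h2 : Tendsto (fun n : ℕ => Real.arctan (ε * (n : ℝ) / r)) atTop (𝓝 (Real.pi / 2)) := by
      have hlin : Tendsto (fun n : ℕ => ε * (n : ℝ) / r) atTop atTop :=
        Tendsto.atTop_div_const hr (Tendsto.const_mul_atTop hε tendsto_natCast_atTop_atTop)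
      exact (Real.tendsto_arctan_atTop.mono_right nhdsWithin_le_nhds).comp hlin
    have h3 := h1.add (h2.const_mul (5 / 16 * ((r⁻¹) ^ 7 / ε)))
    have e1 : (0 : ℝ) + 5 / 16 * ((r⁻¹) ^ 7 / ε) * (Real.pi / 2) = L := by rw [hL]; ring
    rw [e1] at h3
    exact h3
  -- conclude
  have hlim1 : Tendsto (fun n : ℕ => ∑ k ∈ Finset.range (n + 1), g k) atTop (𝓝 (∑' k : ℕ, g k)) :=
    hsum.hasSum.tendsto_sum_nat.comp (tendsto_add_atTop_nat 1)
  have hlim2 : Tendsto (fun n : ℕ => (r⁻¹) ^ 8 + G n) atTop (𝓝 ((r⁻¹) ^ 8 + L)) := hGlim.const_add _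
  have hle := le_of_tendsto_of_tendsto' hlim1 hlim2 hpart
  refine ⟨hsum.congr fun k => (hgk k).symm, ?_⟩
  calc ∑' k : ℕ, ((r ^ 2 + (k : ℝ) ^ 2 * ε ^ 2)⁻¹) ^ 4 = ∑' k : ℕ, g k := tsum_congr hgk
    _ ≤ (r⁻¹) ^ 8 + L := hle

end Sum

end Summit.AtomisticToContinuum.Crystallization.Theorems.StrictSplittingRuleBirth

end
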